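import Literature.Topology.FourManifolds.LatticeFormsOrientationCharacterInternalSum
import Literature.Topology.FourManifolds.LatticeFormsStableOrthogonalGroupSmallDiscriminant
import HarnessLib

/-!
# `O⁺(L, h)` and `Õ⁺(L, h)` as subgroups of `O(h^⊥)`: `O⁺(L, h)|_{h^⊥} = {γ ∈ O⁺(h^⊥) | γ̄|_{p(H)} = id}`,
# `Õ⁺(L_{2t}, h_d) ≅ Õ⁺(h_d^⊥)`, `Õ⁺(L_{2,2d}) = O⁺(L_2, h_d)|` (Gritsenko–Hulek–Sankaran, *Compositio Math.* 146 (2010)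
# §3 (the groups `Γ⁺ < O(L_{h^⊥})`, Thm. 3.3), §4 Lemma 4.2, Prop. 4.12 (i), §5)

Trunk T-4MAN vocabulary; the `O⁺` upgrade of `LatticeFormsStableOrthogonalGroupStabiliser.lean` (row g42-#2: `Õ(L, h)|_{h^⊥} =
Õ(h^⊥)` and `O(L, h)|_{h^⊥} = {γ ∈ O(h^⊥) | γ̄|_{p(H)} = id}` for every non-degenerate symmetric `L`, `(h, h) ≠ 0`, and
the models `B₀ ⊕ ⟨−2t⟩`, `(E₈(−1)^{⊕m} ⊕ U^{⊕k}) ⊕ ℤ(−2t)`) and of `LatticeFormsStableOrthogonalGroupSmallDiscriminant.lean`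
(row g42: `|D(L)| ≤ 2 ⟹ Õ(L) = O(L)`, "`Õ(L_{2,2d}) = Õ(L_2, h_d) = O(L_2, h_d)`"), using the orientation character
`IsometryEquiv.IsOrientationPreserving` (`LatticeFormsOrientationCharacter.lean`: `O⁺(L) = ker`, GHS's "real spin norm 1"
convention) and the two laws of `LatticeFormsOrientationCharacterRestriction.lean` ∕ `…InternalSum.lean` (rows g47-#2, g47-#4):
an isometry `G` with `G h = h` lies in `O⁺(L)` iff `G|_{h^⊥}` lies in `O⁺(h^⊥)`
(`IsometryEquiv.isOrientationPreserving_iff_of_apply_eq`), and Prop. 4.12 (i) with `O⁺`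
(`setOf_discriminantGroupCongr_eq_id_and_isOrientationPreserving_eq_setOf_exists_stable_apply_eq`). Written for lane
`lit-hodgefound` (Track 2 foundations; prover seat `lit-hodgefound-p18`, gen 47, row g47-#5). THEOREMS ONLY — no
definition, no named fact, no instance, no notation.

## Source, verbatim (V. Gritsenko, K. Hulek, G. K. Sankaran, Compositio Math. 146 (2010) 404–434, arXiv numbering;
held text `paper:arxiv-0802.2078` pp. 5–6, 8, 12, 14)

§3 (p. 5–6): "For a primitive element `h ∈ L` with `h² = d > 0`, we define the groups `O(L,h) = {g ∈ O(L) | g(h) = h}`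
and `Õ(L,h) = {g ∈ Õ(L) | g(h) = h}`. For any subgroup `Γ ⊂ O(L)` we […] `PΓ = Γ/(±1)`. If `L` is indefinite we define
`Γ⁺` to be the subgroup of `Γ` of elements with real spin norm `1`. We can consider `O(L,h)` and `Õ(L,h)` as subgroups of
`O(L_{h^⊥})`, where `L_{h^⊥}` is, as usual, the lattice perpendicular to `h` in `L`. […] the lattice `L_{h^⊥}` determines a
homogeneous domain `Ω_h = Ω_{L_{h^⊥}}` of type IV on which the three groups act, and if `Γ < O(L_{h^⊥})` then `Γ⁺` is the
subgroup of `Γ` that preserves the component `𝒟`." Thm. 3.3 (p. 8): "the map `φ` […] factors through the finite cover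
`Õ⁺(L_{2n−2},h)∖𝒟_h → O⁺(L_{2n−2},h)∖𝒟_h`". §4 (p. 12): "According to Lemma 4.2,
`O(L_{2t}, h_d) ≅ {γ ∈ O(h_d^⊥) | γ̄|_{p(H)} = id}`. […] **Proposition 4.12.** […] (i) `Õ(L_{2t}, h_d) ≅ Õ((h_d)^⊥_{L_{2t}})`."
§5 (p. 14): "In this case, where `t = 1`, we have `Õ(L_{2,2d}) = Õ(L_2,h_d) = O(L_2,h_d)` by Proposition 4.12 (i) and
Corollary 4.13 […] Recall that `Õ⁺(L_{2,2d})` is the index `2` subgroup of `Õ(L_{2,2d})` that preserves `𝒟(L_{2,2d})`. Then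
`Õ(L_2,h_d)∖Ω_{h_d} = Õ⁺(L_{2,2d})∖𝒟(L_{2,2d})`."

## Contents (all proved) and reading notes

* WHY A SEPARATE STATEMENT IS NEEDED. GHS take `⁺` of `O(L, h)`, `Õ(L, h)` *inside* `O(L_{h^⊥})` (real spin norm of the
  restriction), while `O⁺(L)` is defined by the spin norm in `L ⊗ ℝ`; that the two agree on `O(L, h)` — so that
  `O⁺(L, h) := O⁺(L) ∩ O(L, h)` and "`O(L, h)⁺ < O(L_{h^⊥})`" are the same group — is row g47-#2's
  `IsometryEquiv.isOrientationPreserving_iff_of_apply_eq` (O'Meara §55:4 with `θ(1_{ℤh}) = 1`). This file spells out the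
  resulting identifications of subsets of `O(h^⊥)`.
* §1 Any non-degenerate symmetric `L = (M, B)`, `(h, h) ≠ 0`: **`O⁺(L, h)|_{h^⊥} = {γ ∈ O⁺(h^⊥) | γ̄|_{p(H)} = id}`**
  (`setOf_toDiscriminantGroup_eq_and_isOrientationPreserving_eq_setOf_exists_isOrientationPreserving_apply_eq`, with its two
  directions), and for **`|D(L)| ≤ 2`** (so `Õ(L) = O(L)`): `Õ⁺(h^⊥) = O⁺(L, h)|_{h^⊥}` and
  `Õ⁺(S^⊥) = {G|_{S^⊥} | G ∈ O⁺(L), G|_S = id}` for every sublattice `S` with `B|_S` non-degenerate.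
* §2 **Prop. 4.12 (i)⁺ `Õ⁺(L_{2t}, h_d) ≅ Õ⁺(h_d^⊥)`** and §1 verbatim for `L = B₀ ⊕ ⟨−2t⟩` (`B₀` symmetric unimodular —
  `3U ⊕ 2E₈(−1)` gives `L_{2t}` —, `t ≥ 1`, `h² = 2d ≠ 0`; as in the `Õ` files neither primitivity of `h` nor `w = 1` is
  used), and for `t = 1`: **`Õ⁺(L_{2,2d}) = Õ⁺(L_2, h_d)|_{h_d^⊥} = O⁺(L_2, h_d)|_{h_d^⊥}`**.
* §3 The same for the coordinate models `(E₈(−1)^{⊕m} ⊕ U^{⊕k}) ⊕ ℤ(−2t)` (`L_{2t}`: `m = 2`, `k = 3`).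
* GROUPS: as in the sibling files, "`≅`" ∕ "`=`" between a subgroup of `O(L, h)` and a subgroup of `O(h^⊥)` is the equality
  of subsets of `O(h^⊥)` (restriction is injective on `O(L, h)`: `isometryEquiv_apply_eq_of_apply_eq_of_forall_coe_apply_eq`);
  `O⁺ = IsometryEquiv.IsOrientationPreserving`, `Õ = {g | ḡ = id}`, `p(H)` = range of `B.toDiscriminantGroup h^⊥`.
  The quotients `∖𝒟_h`, `∖Ω_h` (analytic) are not in this file.

## References

* [GritsenkoHulekSankaran2010Symplectic] V. Gritsenko, K. Hulek, G. K. Sankaran, Moduli spaces of irreducible symplectic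
  manifolds, Compositio Math. 146 (2010) 404–434 (arXiv:0802.2078): §3 (groups `Γ⁺`, Thm. 3.3, Remark 3.4), §4 Lemma 4.2,
  Prop. 4.12 (i), Cor. 4.13, §5.
* [GritsenkoHulekSankaran2013ModuliK3] V. Gritsenko, K. Hulek, G. K. Sankaran, Moduli of K3 surfaces and irreducible
  symplectic manifolds, Handbook of Moduli I (2013): §7 Lemma 7.1, §8 ("`Õ⁺(L) < O⁺(II_{2,26})`").
* [Huybrechts2016K3] D. Huybrechts, Lectures on K3 surfaces (2016), Ch. 14 Cor. 2.7 (the unimodular case `|D(L)| = 1`).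
-/

noncomputable section

open Module Function
open LinearMap (BilinForm)
open Literature.Topology.FourManifolds

namespace LinearMap.BilinForm

/-! ### §1 General lattices: `O⁺(L, h)|_{h^⊥} = {γ ∈ O⁺(h^⊥) | γ̄|_{p(H)} = id}`; `|D(L)| ≤ 2` -/

section General

variable {M : Type*} [AddCommGroup M] [Module.Finite ℤ M] [Module.Free ℤ M] (B : BilinForm ℤ M)

/-- **`O⁺(L, h)|_{h^⊥} = {γ ∈ O⁺(h^⊥) | γ̄|_{p(H)} = id}`** (`B` non-degenerate symmetric, `(h, h) ≠ 0`): an isometry `γ`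
of `h^⊥` is the restriction of an ORIENTATION-PRESERVING isometry of `L` fixing `h` iff `γ̄` fixes every class
`[(x, ·)|_{h^⊥}]`, `x ∈ L`, AND `γ ∈ O⁺(h^⊥)` — the first display of the proof of Prop. 4.12 (Lemma 4.2) for the group
`O⁺(L, h)` of Thm. 3.3 "considered as a subgroup of `O(L_{h^⊥})`", the `⁺` being the same whether read in `L` or in
`h^⊥` (`IsometryEquiv.isOrientationPreserving_iff_of_apply_eq`).
[cite: GritsenkoHulekSankaran2010Symplectic, §3 ("We can consider `O(L,h)` and `Õ(L,h)` as subgroups of `O(L_{h^⊥})` … `Γ⁺`"), Thm. 3.3 (`O⁺(L_{2n−2},h)∖𝒟_h`), §4 Lemma 4.2 and proof of Prop. 4.12 ("`O(L_{2t}, h_d) ≅ {γ ∈ O(h_d^⊥) | γ̄|_{p(H)} = id}`")] -/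
theorem setOf_toDiscriminantGroup_eq_and_isOrientationPreserving_eq_setOf_exists_isOrientationPreserving_apply_eq
    (hBn : B.Nondegenerate) (hB : B.IsSymm) {h : M} (hh : B h h ≠ 0) :
    {γ : (B.restrict (B.orthogonal (ℤ ∙ h))).IsometryEquiv (B.restrict (B.orthogonal (ℤ ∙ h))) |
        (∀ x : M, γ.discriminantGroupCongr (B.toDiscriminantGroup (B.orthogonal (ℤ ∙ h)) x) =
          B.toDiscriminantGroup (B.orthogonal (ℤ ∙ h)) x) ∧ γ.IsOrientationPreserving} =
      {γ | ∃ G : B.IsometryEquiv B, G.IsOrientationPreserving ∧ G h = h ∧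
        ∀ n : B.orthogonal (ℤ ∙ h), G n = γ n} := by
  ext γ
  have h42 := Set.ext_iff.1 (B.setOf_discriminantGroupCongr_toDiscriminantGroup_eq_eq_setOf_exists_apply_eq hBn hB hh) γ
  simp only [Set.mem_setOf_eq] at h42 ⊢
  constructor
  · rintro ⟨hγ, hγ'⟩
    obtain ⟨G, hGh, hG⟩ := h42.1 hγ
    exact ⟨G, (G.isOrientationPreserving_iff_of_apply_eq hB hBn hh hGh γ hG).2 hγ', hGh, hG⟩
  · rintro ⟨G, hG', hGh, hG⟩
    exact ⟨h42.2 ⟨G, hGh, hG⟩, (G.isOrientationPreserving_iff_of_apply_eq hB hBn hh hGh γ hG).1 hG'⟩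

variable {B}

/-- **`{γ ∈ O⁺(h^⊥) | γ̄|_{p(H)} = id} → O⁺(L, h)`**: such a `γ` is the restriction of some `G ∈ O⁺(L)` with `G h = h`.
[cite: GritsenkoHulekSankaran2010Symplectic, §4 Lemma 4.2 (ii) and §3 (the groups `O(L,h)⁺ < O(L_{h^⊥})`)] -/
theorem exists_isOrientationPreserving_apply_eq_of_toDiscriminantGroup_eq (hBn : B.Nondegenerate) (hB : B.IsSymm)
    {h : M} (hh : B h h ≠ 0) (γ : (B.restrict (B.orthogonal (ℤ ∙ h))).IsometryEquiv (B.restrict (B.orthogonal (ℤ ∙ h))))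
    (hγ : ∀ x : M, γ.discriminantGroupCongr (B.toDiscriminantGroup (B.orthogonal (ℤ ∙ h)) x) =
      B.toDiscriminantGroup (B.orthogonal (ℤ ∙ h)) x) (hγ' : γ.IsOrientationPreserving) :
    ∃ G : B.IsometryEquiv B, G.IsOrientationPreserving ∧ G h = h ∧ ∀ n : B.orthogonal (ℤ ∙ h), G n = γ n :=
  (Set.ext_iff.1
    (B.setOf_toDiscriminantGroup_eq_and_isOrientationPreserving_eq_setOf_exists_isOrientationPreserving_apply_eq hBn hB hh)
    γ).1 ⟨hγ, hγ'⟩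

/-- **`O⁺(L, h) → {γ ∈ O⁺(h^⊥) | γ̄|_{p(H)} = id}`**, with the restriction supplied: every `G ∈ O⁺(L)` with `G h = h` HAS
a restriction `γ` to `h^⊥`, `γ̄|_{p(H)} = id` and `γ ∈ O⁺(h^⊥)`.
[cite: GritsenkoHulekSankaran2010Symplectic, §3 ("We can consider `O(L,h)` … as subgroups of `O(L_{h^⊥})`", Thm. 3.3) and §4 Lemma 4.2] -/
theorem exists_restrict_toDiscriminantGroup_eq_and_isOrientationPreserving_of_apply_eq (hBn : B.Nondegenerate)
    (hB : B.IsSymm) {h : M} (hh : B h h ≠ 0) (G : B.IsometryEquiv B) (hG' : G.IsOrientationPreserving) (hGh : G h = h) :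
    ∃ γ : (B.restrict (B.orthogonal (ℤ ∙ h))).IsometryEquiv (B.restrict (B.orthogonal (ℤ ∙ h))),
      (∀ n : B.orthogonal (ℤ ∙ h), (γ n : M) = G n) ∧
        (∀ x : M, γ.discriminantGroupCongr (B.toDiscriminantGroup (B.orthogonal (ℤ ∙ h)) x) =
          B.toDiscriminantGroup (B.orthogonal (ℤ ∙ h)) x) ∧ γ.IsOrientationPreserving := by
  obtain ⟨γ, hγ⟩ := B.exists_isometryEquiv_restrict_orthogonal_of_apply_eq G hGh
  have hmem := (Set.ext_iff.1
    (B.setOf_toDiscriminantGroup_eq_and_isOrientationPreserving_eq_setOf_exists_isOrientationPreserving_apply_eq hBn hB hh)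
    γ).2 ⟨G, hG', hGh, fun n ↦ (hγ n).symm⟩
  exact ⟨γ, hγ, hmem.1, hmem.2⟩

variable (B)

/-- **`Õ⁺(h^⊥) = O⁺(L, h)|_{h^⊥}` when `|D(L)| ≤ 2`** (`B` non-degenerate symmetric, `(h, h) ≠ 0`): Prop. 4.12 (i)⁺
`Õ⁺(h^⊥) = Õ⁺(L, h)|_{h^⊥}` together with `Õ(L) = O(L)`. For `L` unimodular this is Huybrechts' Cor. 14.2.7 with `O⁺`;
for `L = L_2` (`|D(L_2)| = 2`) it is "`Õ⁺(L_{2,2d}) = O⁺(L_2, h_d)`" (§5, `t = 1`).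
[cite: GritsenkoHulekSankaran2010Symplectic, §5 ("`Õ(L_{2,2d}) = Õ(L_2,h_d) = O(L_2,h_d)` … `Õ⁺(L_{2,2d})` is the index 2 subgroup of `Õ(L_{2,2d})` that preserves `𝒟(L_{2,2d})`") and §4 Prop. 4.12 (i)] [cite: Huybrechts2016K3, Ch. 14 Cor. 2.7] -/
theorem setOf_discriminantGroupCongr_eq_id_and_isOrientationPreserving_eq_setOf_exists_apply_eq_of_natCard_le_two
    (hBn : B.Nondegenerate) (hB : B.IsSymm) (h2 : Nat.card B.discriminantGroup ≤ 2) {h : M} (hh : B h h ≠ 0) :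
    {g : (B.restrict (B.orthogonal (ℤ ∙ h))).IsometryEquiv (B.restrict (B.orthogonal (ℤ ∙ h))) |
        (∀ a, g.discriminantGroupCongr a = a) ∧ g.IsOrientationPreserving} =
      {g | ∃ G : B.IsometryEquiv B, G.IsOrientationPreserving ∧ G h = h ∧ ∀ n : B.orthogonal (ℤ ∙ h), G n = g n} := by
  rw [B.setOf_discriminantGroupCongr_eq_id_and_isOrientationPreserving_eq_setOf_exists_stable_apply_eq hB hBn hh]
  ext g
  simp only [Set.mem_setOf_eq]
  exact ⟨fun ⟨G, _, hG', hGh, hGn⟩ ↦ ⟨G, hG', hGh, hGn⟩,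
    fun ⟨G, hG', hGh, hGn⟩ ↦ ⟨G, B.discriminantGroupCongr_eq_self_of_natCard_le_two hBn h2 G, hG', hGh, hGn⟩⟩

/-- **`Õ⁺(S^⊥) = {G|_{S^⊥} | G ∈ O⁺(L), G|_S = id}` when `|D(L)| ≤ 2`**, for every sublattice `S` with `B|_S`
non-degenerate (`B` non-degenerate symmetric): Lemma 7.1⁺ ∕ Prop. 4.12 (i)⁺ for `S` together with `Õ(L) = O(L)`.
[cite: GritsenkoHulekSankaran2010Symplectic, §4 Prop. 4.12 (i) and Cor. 4.13, §5] [cite: GritsenkoHulekSankaran2013ModuliK3, §7 Lemma 7.1 and §8 ("`Õ⁺(L) < O⁺(II_{2,26})`")] [cite: Huybrechts2016K3, Ch. 14 Cor. 2.7] -/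
theorem setOf_discriminantGroupCongr_eq_id_and_isOrientationPreserving_eq_setOf_exists_forall_apply_eq_of_natCard_le_two
    (hBn : B.Nondegenerate) (hB : B.IsSymm) (h2 : Nat.card B.discriminantGroup ≤ 2) (S : Submodule ℤ M)
    (hS : (B.restrict S).Nondegenerate) :
    {g : (B.restrict (B.orthogonal S)).IsometryEquiv (B.restrict (B.orthogonal S)) |
        (∀ a, g.discriminantGroupCongr a = a) ∧ g.IsOrientationPreserving} =
      {g | ∃ G : B.IsometryEquiv B, G.IsOrientationPreserving ∧ (∀ s ∈ S, G s = s) ∧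
        ∀ n : B.orthogonal S, G n = g n} := by
  rw [B.setOf_discriminantGroupCongr_eq_id_and_isOrientationPreserving_eq_setOf_exists_stable hB hBn S hS]
  ext g
  simp only [Set.mem_setOf_eq]
  exact ⟨fun ⟨G, _, hG', hGS, hGn⟩ ↦ ⟨G, hG', hGS, hGn⟩,
    fun ⟨G, hG', hGS, hGn⟩ ↦ ⟨G, B.discriminantGroupCongr_eq_self_of_natCard_le_two hBn h2 G, hG', hGS, hGn⟩⟩

end General

end LinearMap.BilinForm

namespace Literature.Topology.FourManifolds

open LinearMap.BilinForm

/-! ### §2 `L = B₀ ⊕ ⟨−2t⟩`, `B₀` unimodular: Prop. 4.12 (i)⁺, `O⁺(L, h)|_{h^⊥}`, and `t = 1` -/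

section Abstract

variable {M : Type*} [AddCommGroup M] [Module.Finite ℤ M] [Module.Free ℤ M] (B₀ : BilinForm ℤ M) (t : ℕ)

/-- **Prop. 4.12 (i) with `O⁺` for `L = B₀ ⊕ ⟨−2t⟩`** (`B₀` symmetric unimodular — e.g. `3U ⊕ 2E₈(−1)`, giving `L_{2t}` —,
`t ≥ 1`): for `h ∈ L` with `h² = 2d`, `d ≠ 0`, **`Õ⁺(h^⊥) = {G|_{h^⊥} | G ∈ Õ(L) ∩ O⁺(L), G h = h} ≅ Õ⁺(L, h)`** — the
group `Õ⁺(L_{2n−2}, h)` of Thm. 3.3 read inside `O(L_{h^⊥})`. Printed (for `Õ`) with `h_d` primitive and `w = 1`; neither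
is needed. [cite: GritsenkoHulekSankaran2010Symplectic, §4 Prop. 4.12 (i) and §3 Thm. 3.3 ("`Õ⁺(L_{2n−2},h)∖𝒟_h`")] -/
theorem setOf_discriminantGroupCongr_eq_id_and_isOrientationPreserving_eq_of_prod_neg_twoMul (hs : B₀.IsSymm)
    (hu : B₀.IsUnimodular) (ht : 0 < t) {h : M × ℤ} {d : ℤ} (hd : d ≠ 0)
    (hh : B₀.prod ((-(2 * t : ℤ)) • LinearMap.mul ℤ ℤ) h h = 2 * d) :
    {g : ((B₀.prod ((-(2 * t : ℤ)) • LinearMap.mul ℤ ℤ)).restrict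
          ((B₀.prod ((-(2 * t : ℤ)) • LinearMap.mul ℤ ℤ)).orthogonal (ℤ ∙ h))).IsometryEquiv
        ((B₀.prod ((-(2 * t : ℤ)) • LinearMap.mul ℤ ℤ)).restrict
          ((B₀.prod ((-(2 * t : ℤ)) • LinearMap.mul ℤ ℤ)).orthogonal (ℤ ∙ h))) |
        (∀ a, g.discriminantGroupCongr a = a) ∧ g.IsOrientationPreserving} =
      {g | ∃ G : (B₀.prod ((-(2 * t : ℤ)) • LinearMap.mul ℤ ℤ)).IsometryEquiv
          (B₀.prod ((-(2 * t : ℤ)) • LinearMap.mul ℤ ℤ)),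
        (∀ a, G.discriminantGroupCongr a = a) ∧ G.IsOrientationPreserving ∧ G h = h ∧
          ∀ n : (B₀.prod ((-(2 * t : ℤ)) • LinearMap.mul ℤ ℤ)).orthogonal (ℤ ∙ h), G n = g n} :=
  (B₀.prod ((-(2 * t : ℤ)) • LinearMap.mul ℤ ℤ)).setOf_discriminantGroupCongr_eq_id_and_isOrientationPreserving_eq_setOf_exists_stable_apply_eq
    (hs.prod (isSymm_smul_mul _)) (nondegenerate_prod_neg_twoMul_smul_mul B₀ t hu ht) (by rw [hh]; omega)

/-- **`O⁺(L, h)|_{h^⊥} = {γ ∈ O⁺(h^⊥) | γ̄|_{p(H)} = id}` for `L = B₀ ⊕ ⟨−2t⟩`** (`B₀` symmetric unimodular, `t ≥ 1`,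
`h² = 2d ≠ 0`) — the group `O⁺(L_{2n−2}, h)` of Thm. 3.3 read inside `O(L_{h^⊥})`.
[cite: GritsenkoHulekSankaran2010Symplectic, §3 ("`O(L,h)` … as subgroups of `O(L_{h^⊥})`", Thm. 3.3), §4 Lemma 4.2 and proof of Prop. 4.12 ("`O(L_{2t}, h_d) ≅ {γ ∈ O(h_d^⊥) | γ̄|_{p(H)} = id}`")] -/
theorem setOf_toDiscriminantGroup_eq_and_isOrientationPreserving_eq_of_prod_neg_twoMul (hs : B₀.IsSymm)
    (hu : B₀.IsUnimodular) (ht : 0 < t) {h : M × ℤ} {d : ℤ} (hd : d ≠ 0)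
    (hh : B₀.prod ((-(2 * t : ℤ)) • LinearMap.mul ℤ ℤ) h h = 2 * d) :
    {γ : ((B₀.prod ((-(2 * t : ℤ)) • LinearMap.mul ℤ ℤ)).restrict
          ((B₀.prod ((-(2 * t : ℤ)) • LinearMap.mul ℤ ℤ)).orthogonal (ℤ ∙ h))).IsometryEquiv
        ((B₀.prod ((-(2 * t : ℤ)) • LinearMap.mul ℤ ℤ)).restrict
          ((B₀.prod ((-(2 * t : ℤ)) • LinearMap.mul ℤ ℤ)).orthogonal (ℤ ∙ h))) |
        (∀ x, γ.discriminantGroupCongr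
            ((B₀.prod ((-(2 * t : ℤ)) • LinearMap.mul ℤ ℤ)).toDiscriminantGroup
              ((B₀.prod ((-(2 * t : ℤ)) • LinearMap.mul ℤ ℤ)).orthogonal (ℤ ∙ h)) x) =
          (B₀.prod ((-(2 * t : ℤ)) • LinearMap.mul ℤ ℤ)).toDiscriminantGroup
            ((B₀.prod ((-(2 * t : ℤ)) • LinearMap.mul ℤ ℤ)).orthogonal (ℤ ∙ h)) x) ∧ γ.IsOrientationPreserving} =
      {γ | ∃ G : (B₀.prod ((-(2 * t : ℤ)) • LinearMap.mul ℤ ℤ)).IsometryEquiv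
          (B₀.prod ((-(2 * t : ℤ)) • LinearMap.mul ℤ ℤ)),
        G.IsOrientationPreserving ∧ G h = h ∧
          ∀ n : (B₀.prod ((-(2 * t : ℤ)) • LinearMap.mul ℤ ℤ)).orthogonal (ℤ ∙ h), G n = γ n} :=
  (B₀.prod ((-(2 * t : ℤ)) • LinearMap.mul ℤ ℤ)).setOf_toDiscriminantGroup_eq_and_isOrientationPreserving_eq_setOf_exists_isOrientationPreserving_apply_eq
    (nondegenerate_prod_neg_twoMul_smul_mul B₀ t hu ht) (hs.prod (isSymm_smul_mul _)) (by rw [hh]; omega)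

/-- **`Õ⁺(L_{2,2d}) = Õ⁺(L_2, h_d)|_{h_d^⊥} = O⁺(L_2, h_d)|_{h_d^⊥}`** for `L_2`-type lattices `B₀ ⊕ ⟨−2⟩` (`B₀` symmetric
unimodular; for `B₀ = 3U ⊕ 2E₈(−1)` the Beauville lattice of `K3^{[2]}`) and every `h` with `h² = 2d ≠ 0`: the
orientation-preserving isometries of `h^⊥` trivial on `D(h^⊥)` are exactly the restrictions of the orientation-preserving
isometries of `L_2` fixing `h` (all of which lie in `Õ(L_2)`, `|D(L_2)| = 2`). For split `h_d`, `h_d^⊥ ≅ L_{2,2d}`.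
[cite: GritsenkoHulekSankaran2010Symplectic, §5 ("where `t = 1`, we have `Õ(L_{2,2d}) = Õ(L_2,h_d) = O(L_2,h_d)` … `Õ⁺(L_{2,2d})` is the index 2 subgroup … that preserves `𝒟(L_{2,2d})`"), §4 Prop. 4.12 (i), Cor. 4.13] -/
theorem setOf_discriminantGroupCongr_eq_id_and_isOrientationPreserving_eq_of_prod_neg_two (hs : B₀.IsSymm)
    (hu : B₀.IsUnimodular) {h : M × ℤ} {d : ℤ} (hd : d ≠ 0) (hh : B₀.prod ((-2 : ℤ) • LinearMap.mul ℤ ℤ) h h = 2 * d) :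
    {g : ((B₀.prod ((-2 : ℤ) • LinearMap.mul ℤ ℤ)).restrict
          ((B₀.prod ((-2 : ℤ) • LinearMap.mul ℤ ℤ)).orthogonal (ℤ ∙ h))).IsometryEquiv
        ((B₀.prod ((-2 : ℤ) • LinearMap.mul ℤ ℤ)).restrict
          ((B₀.prod ((-2 : ℤ) • LinearMap.mul ℤ ℤ)).orthogonal (ℤ ∙ h))) |
        (∀ a, g.discriminantGroupCongr a = a) ∧ g.IsOrientationPreserving} =
      {g | ∃ G : (B₀.prod ((-2 : ℤ) • LinearMap.mul ℤ ℤ)).IsometryEquiv (B₀.prod ((-2 : ℤ) • LinearMap.mul ℤ ℤ)),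
        G.IsOrientationPreserving ∧ G h = h ∧
          ∀ n : (B₀.prod ((-2 : ℤ) • LinearMap.mul ℤ ℤ)).orthogonal (ℤ ∙ h), G n = g n} :=
  setOf_discriminantGroupCongr_eq_id_and_isOrientationPreserving_eq_setOf_exists_apply_eq_of_natCard_le_two _
    (nondegenerate_prod_neg_two_smul_mul B₀ hu) (hs.prod (isSymm_smul_mul _))
    (by rw [natCard_discriminantGroup_prod_neg_two_smul_mul B₀ hu]) (by rw [hh]; omega)

end Abstract

/-! ### §3 The models `(E₈(−1)^{⊕m} ⊕ U^{⊕k}) ⊕ ℤ(−2t)` (`L_{2t} = 3U ⊕ 2E₈(−1) ⊕ ⟨−2t⟩`: `m = 2`, `k = 3`) -/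

section Model

variable (m k t : ℕ)

/-- **Prop. 4.12 (i) with `O⁺`, verbatim for `L_{2t}` and its relatives `(E₈(−1)^{⊕m} ⊕ U^{⊕k}) ⊕ ℤ(−2t)`** (`t ≥ 1`;
`h² = 2d`, `d ≠ 0`): `Õ⁺(h^⊥) = {G|_{h^⊥} | G ∈ Õ(L) ∩ O⁺(L), G h = h} ≅ Õ⁺(L, h)`.
[cite: GritsenkoHulekSankaran2010Symplectic, §4 Prop. 4.12 (i) ("`Õ(L_{2t}, h_d) ≅ Õ((h_d)^⊥_{L_{2t}})`") and §3 Thm. 3.3 ("`Õ⁺(L_{2n−2},h)∖𝒟_h`")] -/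
theorem setOf_discriminantGroupCongr_eq_id_and_isOrientationPreserving_eq_of_model (ht : 0 < t)
    {h : ((Fin m → Fin 8 → ℤ) × ((Fin k → ℤ) × (Fin k → ℤ))) × ℤ} {d : ℤ} (hd : d ≠ 0)
    (hh : (((LinearMap.BilinForm.pi fun _ : Fin m ↦ -e8Form).prod (hyperbolicSum k)).prod
      ((-(2 * t : ℤ)) • LinearMap.mul ℤ ℤ)) h h = 2 * d) :
    {g : ((((LinearMap.BilinForm.pi fun _ : Fin m ↦ -e8Form).prod (hyperbolicSum k)).prod
            ((-(2 * t : ℤ)) • LinearMap.mul ℤ ℤ)).restrict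
          ((((LinearMap.BilinForm.pi fun _ : Fin m ↦ -e8Form).prod (hyperbolicSum k)).prod
            ((-(2 * t : ℤ)) • LinearMap.mul ℤ ℤ)).orthogonal (ℤ ∙ h))).IsometryEquiv
        ((((LinearMap.BilinForm.pi fun _ : Fin m ↦ -e8Form).prod (hyperbolicSum k)).prod
            ((-(2 * t : ℤ)) • LinearMap.mul ℤ ℤ)).restrict
          ((((LinearMap.BilinForm.pi fun _ : Fin m ↦ -e8Form).prod (hyperbolicSum k)).prod
            ((-(2 * t : ℤ)) • LinearMap.mul ℤ ℤ)).orthogonal (ℤ ∙ h))) |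
        (∀ a, g.discriminantGroupCongr a = a) ∧ g.IsOrientationPreserving} =
      {g | ∃ G : (((LinearMap.BilinForm.pi fun _ : Fin m ↦ -e8Form).prod (hyperbolicSum k)).prod
            ((-(2 * t : ℤ)) • LinearMap.mul ℤ ℤ)).IsometryEquiv
          (((LinearMap.BilinForm.pi fun _ : Fin m ↦ -e8Form).prod (hyperbolicSum k)).prod
            ((-(2 * t : ℤ)) • LinearMap.mul ℤ ℤ)),
        (∀ a, G.discriminantGroupCongr a = a) ∧ G.IsOrientationPreserving ∧ G h = h ∧
          ∀ n : (((LinearMap.BilinForm.pi fun _ : Fin m ↦ -e8Form).prod (hyperbolicSum k)).prod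
            ((-(2 * t : ℤ)) • LinearMap.mul ℤ ℤ)).orthogonal (ℤ ∙ h), G n = g n} := by
  obtain ⟨hsB, -, huB⟩ := isSymm_isEven_isUnimodular_pi_neg_e8Form_prod_hyperbolicSum' m k
  exact setOf_discriminantGroupCongr_eq_id_and_isOrientationPreserving_eq_of_prod_neg_twoMul _ t hsB huB ht hd hh

/-- **`O⁺(L, h)|_{h^⊥} = {γ ∈ O⁺(h^⊥) | γ̄|_{p(H)} = id}` for the models `(E₈(−1)^{⊕m} ⊕ U^{⊕k}) ⊕ ℤ(−2t)`** (`t ≥ 1`,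
`h² = 2d ≠ 0`) — the group `O⁺(L_{2n−2}, h)` of Thm. 3.3 read inside `O(L_{h^⊥})`.
[cite: GritsenkoHulekSankaran2010Symplectic, §3 (Thm. 3.3, "`O(L,h)` … as subgroups of `O(L_{h^⊥})`"), §4 Lemma 4.2 and proof of Prop. 4.12] -/
theorem setOf_toDiscriminantGroup_eq_and_isOrientationPreserving_eq_of_model (ht : 0 < t)
    {h : ((Fin m → Fin 8 → ℤ) × ((Fin k → ℤ) × (Fin k → ℤ))) × ℤ} {d : ℤ} (hd : d ≠ 0)
    (hh : (((LinearMap.BilinForm.pi fun _ : Fin m ↦ -e8Form).prod (hyperbolicSum k)).prod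
      ((-(2 * t : ℤ)) • LinearMap.mul ℤ ℤ)) h h = 2 * d) :
    {γ : ((((LinearMap.BilinForm.pi fun _ : Fin m ↦ -e8Form).prod (hyperbolicSum k)).prod
            ((-(2 * t : ℤ)) • LinearMap.mul ℤ ℤ)).restrict
          ((((LinearMap.BilinForm.pi fun _ : Fin m ↦ -e8Form).prod (hyperbolicSum k)).prod
            ((-(2 * t : ℤ)) • LinearMap.mul ℤ ℤ)).orthogonal (ℤ ∙ h))).IsometryEquiv
        ((((LinearMap.BilinForm.pi fun _ : Fin m ↦ -e8Form).prod (hyperbolicSum k)).prod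
            ((-(2 * t : ℤ)) • LinearMap.mul ℤ ℤ)).restrict
          ((((LinearMap.BilinForm.pi fun _ : Fin m ↦ -e8Form).prod (hyperbolicSum k)).prod
            ((-(2 * t : ℤ)) • LinearMap.mul ℤ ℤ)).orthogonal (ℤ ∙ h))) |
        (∀ x, γ.discriminantGroupCongr
            ((((LinearMap.BilinForm.pi fun _ : Fin m ↦ -e8Form).prod (hyperbolicSum k)).prod
              ((-(2 * t : ℤ)) • LinearMap.mul ℤ ℤ)).toDiscriminantGroup
              ((((LinearMap.BilinForm.pi fun _ : Fin m ↦ -e8Form).prod (hyperbolicSum k)).prod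
                ((-(2 * t : ℤ)) • LinearMap.mul ℤ ℤ)).orthogonal (ℤ ∙ h)) x) =
          (((LinearMap.BilinForm.pi fun _ : Fin m ↦ -e8Form).prod (hyperbolicSum k)).prod
              ((-(2 * t : ℤ)) • LinearMap.mul ℤ ℤ)).toDiscriminantGroup
            ((((LinearMap.BilinForm.pi fun _ : Fin m ↦ -e8Form).prod (hyperbolicSum k)).prod
              ((-(2 * t : ℤ)) • LinearMap.mul ℤ ℤ)).orthogonal (ℤ ∙ h)) x) ∧ γ.IsOrientationPreserving} =
      {γ | ∃ G : (((LinearMap.BilinForm.pi fun _ : Fin m ↦ -e8Form).prod (hyperbolicSum k)).prod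
            ((-(2 * t : ℤ)) • LinearMap.mul ℤ ℤ)).IsometryEquiv
          (((LinearMap.BilinForm.pi fun _ : Fin m ↦ -e8Form).prod (hyperbolicSum k)).prod
            ((-(2 * t : ℤ)) • LinearMap.mul ℤ ℤ)),
        G.IsOrientationPreserving ∧ G h = h ∧
          ∀ n : (((LinearMap.BilinForm.pi fun _ : Fin m ↦ -e8Form).prod (hyperbolicSum k)).prod
            ((-(2 * t : ℤ)) • LinearMap.mul ℤ ℤ)).orthogonal (ℤ ∙ h), G n = γ n} := by
  obtain ⟨hsB, -, huB⟩ := isSymm_isEven_isUnimodular_pi_neg_e8Form_prod_hyperbolicSum' m k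
  exact setOf_toDiscriminantGroup_eq_and_isOrientationPreserving_eq_of_prod_neg_twoMul _ t hsB huB ht hd hh

/-- **`Õ⁺(L_{2,2d}) = Õ⁺(L_2, h_d)| = O⁺(L_2, h_d)|` for the model `L_2 = (E₈(−1)^{⊕m} ⊕ U^{⊕k}) ⊕ ℤ(−2)`** (`K3^{[2]}`:
`m = 2`, `k = 3`) and every `h` with `h² = 2d ≠ 0`.
[cite: GritsenkoHulekSankaran2010Symplectic, §5 ("where `t = 1` … `Õ⁺(L_{2,2d})` is the index 2 subgroup of `Õ(L_{2,2d})` that preserves `𝒟(L_{2,2d})`"), §4 Prop. 4.12 (i), Cor. 4.13] -/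
theorem setOf_discriminantGroupCongr_eq_id_and_isOrientationPreserving_eq_of_model_one
    {h : ((Fin m → Fin 8 → ℤ) × ((Fin k → ℤ) × (Fin k → ℤ))) × ℤ} {d : ℤ} (hd : d ≠ 0)
    (hh : (((LinearMap.BilinForm.pi fun _ : Fin m ↦ -e8Form).prod (hyperbolicSum k)).prod
      ((-2 : ℤ) • LinearMap.mul ℤ ℤ)) h h = 2 * d) :
    {g : ((((LinearMap.BilinForm.pi fun _ : Fin m ↦ -e8Form).prod (hyperbolicSum k)).prod
            ((-2 : ℤ) • LinearMap.mul ℤ ℤ)).restrict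
          ((((LinearMap.BilinForm.pi fun _ : Fin m ↦ -e8Form).prod (hyperbolicSum k)).prod
            ((-2 : ℤ) • LinearMap.mul ℤ ℤ)).orthogonal (ℤ ∙ h))).IsometryEquiv
        ((((LinearMap.BilinForm.pi fun _ : Fin m ↦ -e8Form).prod (hyperbolicSum k)).prod
            ((-2 : ℤ) • LinearMap.mul ℤ ℤ)).restrict
          ((((LinearMap.BilinForm.pi fun _ : Fin m ↦ -e8Form).prod (hyperbolicSum k)).prod
            ((-2 : ℤ) • LinearMap.mul ℤ ℤ)).orthogonal (ℤ ∙ h))) |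
        (∀ a, g.discriminantGroupCongr a = a) ∧ g.IsOrientationPreserving} =
      {g | ∃ G : (((LinearMap.BilinForm.pi fun _ : Fin m ↦ -e8Form).prod (hyperbolicSum k)).prod
            ((-2 : ℤ) • LinearMap.mul ℤ ℤ)).IsometryEquiv
          (((LinearMap.BilinForm.pi fun _ : Fin m ↦ -e8Form).prod (hyperbolicSum k)).prod
            ((-2 : ℤ) • LinearMap.mul ℤ ℤ)),
        G.IsOrientationPreserving ∧ G h = h ∧
          ∀ n : (((LinearMap.BilinForm.pi fun _ : Fin m ↦ -e8Form).prod (hyperbolicSum k)).prod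
            ((-2 : ℤ) • LinearMap.mul ℤ ℤ)).orthogonal (ℤ ∙ h), G n = g n} := by
  obtain ⟨hsB, -, huB⟩ := isSymm_isEven_isUnimodular_pi_neg_e8Form_prod_hyperbolicSum' m k
  exact setOf_discriminantGroupCongr_eq_id_and_isOrientationPreserving_eq_of_prod_neg_two _ hsB huB hd hh

end Model

end Literature.Topology.FourManifolds
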